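import Summits.ABC.IUTFork.LDHCor312
import Literature.IUT.LogVolume.PrimewiseLine
import HarnessLib

/-!
# The fork at [IUTchIII] Corollary 3.12, L-DH level (c312-3), II-c: Dupuy–Hilado data assembled prime by
# prime (the `DHData` of `LDHCor312` over a primewise packet model)

Record-only file (D-0012) of the abc-iut cell (Cor. 3.12 sub-crew, seat abc-iut-c312-3); TAKES NO SIDE.
Dupuy–Hilado, arXiv:2004.13228 (pre-split text) Def. 3.6.3 "`𝕃 = Π_p 𝕃_p`, `ln ν̄_𝕃(B) = Σ_p ln ν̄_{𝕃_p}(B_p)`",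
§3.9 (the idele `a` with `div(a) = D`), §4.10–4.11 ((Ind3), `U_Θ`), read on the page (render chunks 12, 16).

Every field of `DHData` (`LDHCor312.lean`) is LOCAL AT THE INDEX `p`: the ideles `t_Θ`, `t_q` are families of
local scalars, the (Ind3)-datum is a family of regions with summandwise constraints, and `hull(U_Θ)` is formed
summand by summand. This file makes the assembly explicit, so that the REAL data (tensor packets at primes,
`LDHTensor.lean`) can be supplied prime by prime:

* `PrimePacket.regionOf`, `PrimePacket.localUTheta` — the `p`-local copies of `O_𝕃(−div t)` and of the union
  of the possible images `⋃_{g,σ} g·σ·B`; `IndPacketModel.UThetaUnion_eq_localUTheta` — for ANY model, the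
  `p`-component of `U_Θ` (a union over GLOBAL (Ind2)×(Ind1)-elements) IS the local union (global elements
  restrict; local ones extend by identities);
* `PrimePacket.DHDatum Q X` — the data of `DHData` at one index over a prime packet `Q`: `t_Θ`, `t_q` with
  their valuations, `(O_𝕃(−P_Θ))^{Ind3}_p` admissible, containing the bare region, bounded by (4.10), and
  `hull(U_Θ)_p` admissible; `PrimePacket.DHDatum.transport` along an equality of packets;
* `PrimePacket.lineDatum` — the canonical datum over the valuation line (every index carries one: `t := P(v)`,
  `bare3 := [0,∞)`), used at the composite junk indices;
* `DHData.ofPrimewise` — a family of data, one per index, IS a `DHData` over `IndPacketModel.ofPrimewise`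
  (every `DHData` field holds componentwise; `hull_adm` through `UThetaUnion_eq_localUTheta`), and
  `DHData.ofPrimesLine` — data given AT PRIMES over `P p hp`, completed by the line datum.

[cite: DupuyHilado2025, Def. 3.6.3, §3.9, §4.10–4.11] [claim: Mochizuki2012, status: disputed] Bookkeeping over
the interface only; nothing asserted. Deliberately NOT here: the real data (`LDHTensor.lean`).
-/

noncomputable section

open Set

namespace Literature.IUT.LogVolume

open NumberField IsDedekindDomain
open scoped Pointwise

variable {F : Type} [Field F] [NumberField F]

/-! ## `p`-local regions: `O_𝕃(−div t)_p` and the local union of possible images -/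

namespace PrimePacket

variable {p : ℕ} (Q : PrimePacket F p)

/-- The `p`-part of `O_𝕃(−div t)` (the same formula as `PacketModel.region`, at one index): in degree
`j = i+1 ∈ {1,…,ℓ⋇}` the translate `t_{j,v_j}·O_{v⃗}`, else `O_{v⃗}`. [cite: DupuyHilado2025, §3.9] -/
def regionOf {lstar : ℕ} (t : Fin lstar → (v : placesOver F p) → Q.Λ v) : Q.Region := fun j e =>
  if h : 0 < j ∧ j - 1 < lstar then Q.peel (t ⟨j - 1, h.2⟩ (e (Fin.last j))) '' Q.O j e else Q.O j e

/-- The `p`-part of `U_Θ` as a LOCAL union: `⋃_{g ∈ G₂(v⃗), σ ∈ S_{j+1}} g·(σ·B)_{v⃗}`.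
[cite: DupuyHilado2025, §4.11] -/
def localUTheta (B : Q.Region) : Q.Region := fun j e =>
  ⋃ (g : Q.G₂ j e) (σ : Equiv.Perm (Fin (j + 1))), g • (Q.perm σ e '' B j (e ∘ σ))

/-- `hull(U_Θ)_p`, locally. [cite: DupuyHilado2025, §4.11–4.12] -/
def localHull (B : Q.Region) : Q.Region := fun j e => Q.hullLoc j e (Q.localUTheta B j e)

end PrimePacket

namespace IndPacketModel

variable (M : IndPacketModel F)

/-- The region `O_𝕃(−div t)` of a model, read at `p`, is the `p`-local `regionOf` of its `p`-part
(definitionally). [cite: DupuyHilado2025, §3.9] -/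
theorem region_eq_regionOf {lstar : ℕ} (t : M.LgpIdele lstar) (p : ℕ) :
    M.regionAt (M.region t) p = (M.primePart p).regionOf (fun i v => t i p v) := rfl

/-- **The `p`-component of `U_Θ` is the local union**: `(⋃_{(g,σ) global} g·σ·B)_{p,j,v⃗} =
⋃_{g ∈ G₂(v⃗), σ ∈ S_{j+1}} g·(σ·B)_{v⃗}` (global indeterminacies restrict to local ones; local ones extend by
identities elsewhere). [cite: DupuyHilado2025, §4.7, §4.9, §4.11] -/
theorem UThetaUnion_eq_localUTheta {lstar : ℕ} {t : M.LgpIdele lstar} (D : M.Ind3Datum t) (p j : ℕ)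
    (e : Fin (j + 1) → placesOver F p) :
    M.UThetaUnion D p j e = (M.primePart p).localUTheta (M.regionAt D.bare3 p) j e := by
  classical
  ext x
  constructor
  · intro hx
    obtain ⟨lam, hx⟩ := Set.mem_iUnion.mp hx
    exact Set.mem_iUnion.mpr ⟨lam.1 p j e, Set.mem_iUnion.mpr ⟨lam.2 j, hx⟩⟩
  · intro hx
    obtain ⟨g, hx⟩ := Set.mem_iUnion.mp hx
    obtain ⟨σ, hx⟩ := Set.mem_iUnion.mp hx
    -- extend `g`, `σ` by identities to global elements
    let G : M.Ind2Elt := Function.update (fun _ => 1 : M.Ind2Elt)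
      p (Function.update (fun _ => 1 : (j' : ℕ) → (e' : Fin (j' + 1) → placesOver F p) → M.G₂ p j' e')
        j (Function.update (fun _ => 1 : (e' : Fin (j + 1) → placesOver F p) → M.G₂ p j e') e g))
    let Sg : M.Ind1Elt := Function.update (fun _ => 1) j σ
    have hG : G p j e = g := by simp [G]
    have hSg : Sg j = σ := by simp [Sg]
    refine Set.mem_iUnion.mpr ⟨(G, Sg), ?_⟩
    show x ∈ G p j e • (M.perm (Sg j) e '' D.bare3 p j (e ∘ Sg j))
    rw [hG, hSg]
    exact hx

/-- Hence `hull(U_Θ)` of a model, read at `p`, is the local hull of its `p`-part.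
[cite: DupuyHilado2025, §4.11–4.12] -/
theorem hullUTheta_eq_localHull {lstar : ℕ} {t : M.LgpIdele lstar} (D : M.Ind3Datum t) (p j : ℕ)
    (e : Fin (j + 1) → placesOver F p) :
    M.hullUTheta D p j e = (M.primePart p).localHull (M.regionAt D.bare3 p) j e := by
  rw [IndPacketModel.hullUTheta, IndPacketModel.hull_apply, UThetaUnion_eq_localUTheta]
  rfl

end IndPacketModel

/-! ## Dupuy–Hilado data at one index -/

namespace PrimePacket

variable {p : ℕ}

/-- **Dupuy–Hilado data at the index `p`** over a prime packet `Q`, for pilot data `X`: the `p`-components of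
the theta- and `q`-ideles with `ord_v(t_{Θ,j,v}) = P_{Θ,j}(v)`, `ord_v(t_{q,j,v}) = P_q(v)` (§3.9), of
`(O_𝕃(−P_Θ))^{Ind3}` — admissible, containing `O_𝕃(−P_Θ)_p`, bounded as in (4.10) — and the admissibility of
`hull(U_Θ)_p` ("`−|log(Θ)| ∈ ℝ`"). HYPOTHESIS data; nothing asserted. [cite: DupuyHilado2025, §3.9, §4.10–4.12] -/
structure DHDatum (Q : PrimePacket F p) (X : PilotData F) where
  /-- `t_{Θ,j,v}`, `v | p` -/
  tΘ : Fin X.lstar → (v : placesOver F p) → Q.Λ v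
  /-- it realises `P_Θ` -/
  tΘ_ord : ∀ (i : Fin X.lstar) (v : placesOver F p), Q.ordv (tΘ i v) = X.thetaPilot i v.1
  /-- `t_{q,j,v}` -/
  tq : Fin X.lstar → (v : placesOver F p) → Q.Λ v
  /-- it realises `P_q` -/
  tq_ord : ∀ (i : Fin X.lstar) (v : placesOver F p), Q.ordv (tq i v) = X.qPilot v.1
  /-- `(O_𝕃(−P_Θ))^{Ind3}_p` -/
  bare3 : Q.Region
  /-- admissible -/
  bare3_adm : Q.RegionAdm bare3
  /-- contains `O_𝕃(−P_Θ)_p` -/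
  region_subset : ∀ j e, Q.regionOf tΘ j e ⊆ bare3 j e
  /-- the bound (4.10) -/
  subset_bound : ∀ (i : Fin X.lstar) (e : Fin ((i : ℕ) + 1 + 1) → placesOver F p),
    bare3 ((i : ℕ) + 1) e ⊆ ⋃ n : ℕ, (Q.peel (tΘ i (e (Fin.last _))))^[n] '' Q.shell ((i : ℕ) + 1) e
  /-- `hull(U_Θ)_p` is admissible -/
  hull_adm : Q.RegionAdm (Q.localHull bare3)

/-- Transport of a datum along an equality of prime packets. [cite: DupuyHilado2025, Def. 3.6.3] -/
def DHDatum.transport {Q Q' : PrimePacket F p} {X : PilotData F} (h : Q = Q') (d : DHDatum Q' X) :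
    DHDatum Q X := PrimePacket.transport (fun R => DHDatum R X) h d

/-! ## The canonical datum over the valuation line -/

/-- The pilot coefficients are nonnegative: `P_{Θ,j}(v) ≥ 0`. [cite: DupuyHilado2025, §3.3] -/
theorem thetaPilot_apply_nonneg (X : PilotData F) (i : Fin X.lstar) (v : HeightOneSpectrum (𝓞 F)) :
    0 ≤ X.thetaPilot i v := by
  classical
  show 0 ≤ (∑ w ∈ X.S, FinDivisor.of w ((((i : ℕ) + 1 : ℝ) ^ 2) * (X.ordq w : ℝ) / (2 * X.l))) v
  rw [Finsupp.finsetSum_apply]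
  refine Finset.sum_nonneg fun w hw => ?_
  rw [FinDivisor.of, Finsupp.single_apply]
  split_ifs
  · have h1 : (0 : ℝ) < X.ordq w := by exact_mod_cast X.ordq_pos hw
    have h2 := X.two_mul_l_pos
    positivity
  · exact le_rfl

/-- The `q`-pilot coefficients are nonnegative: `P_q(v) ≥ 0`. [cite: DupuyHilado2025, §3.3] -/
theorem qPilot_apply_nonneg (X : PilotData F) (v : HeightOneSpectrum (𝓞 F)) : 0 ≤ X.qPilot v := by
  classical
  show 0 ≤ (∑ w ∈ X.S, FinDivisor.of w ((X.ordq w : ℝ) / (2 * X.l))) v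
  rw [Finsupp.finsetSum_apply]
  refine Finset.sum_nonneg fun w hw => ?_
  rw [FinDivisor.of, Finsupp.single_apply]
  split_ifs
  · have h1 : (0 : ℝ) < X.ordq w := by exact_mod_cast X.ordq_pos hw
    have h2 := X.two_mul_l_pos
    positivity
  · exact le_rfl

/-- In the valuation line every region `t·O` with `t ≥ 0` is a ray inside `[0,∞)`.
[cite: DupuyHilado2025, §3.9] -/
theorem line_regionOf_subset (p : ℕ) (X : PilotData F) (j : ℕ) (e : Fin (j + 1) → placesOver F p) :
    ((PrimePacket.line F p).regionOf (lstar := X.lstar) (fun i v => X.thetaPilot i v.1) j e : Set ℝ) ⊆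
      Set.Ici (0 : ℝ) := by
  unfold regionOf
  split_ifs with h
  · show (fun x : ℝ => x + X.thetaPilot ⟨j - 1, h.2⟩ (e (Fin.last j)).1 * Line.c (e (Fin.last j))) ''
        Set.Ici (0 : ℝ) ⊆ Set.Ici 0
    rw [Set.image_add_const_Ici, zero_add]
    refine Set.Ici_subset_Ici.mpr (mul_nonneg (thetaPilot_apply_nonneg X _ _) ?_)
    exact div_nonneg (le_of_lt (logNorm_pos F _)) (Nat.cast_nonneg _)
  · exact le_rfl

/-- **The canonical datum over the valuation line** at any index: `t_{Θ,j,v} := P_{Θ,j}(v)`, `t_{q,j,v} := P_q(v)`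
(`ord = id`), `(O_𝕃(−P_Θ))^{Ind3}_p := [0,∞) = O = I` in every summand (the `n = 0` term of (4.10)); the local
hull is `[0,∞)`. [cite: DupuyHilado2025, §3.9, §4.10–4.12] -/
def lineDatum (p : ℕ) (X : PilotData F) : DHDatum (PrimePacket.line F p) X where
  tΘ i v := X.thetaPilot i v.1
  tΘ_ord _ _ := rfl
  tq _ v := X.qPilot v.1
  tq_ord _ _ := rfl
  bare3 _ _ := (Set.Ici (0 : ℝ) : Set ℝ)
  bare3_adm _ _ := ⟨0, rfl⟩
  region_subset j e := line_regionOf_subset p X j e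
  subset_bound i e := by
    intro x hx
    refine Set.mem_iUnion.mpr ⟨0, ?_⟩
    simpa using hx
  hull_adm j e := by
    refine ⟨0, ?_⟩
    show (⋃ (g : PUnit) (σ : Equiv.Perm (Fin (j + 1))),
        (fun y : ℝ => y) '' ((Equiv.refl ℝ) '' (Set.Ici (0 : ℝ) : Set ℝ))) = Set.Ici 0
    simp [Set.iUnion_const]

end PrimePacket

end Literature.IUT.LogVolume

/-! ## Assembling `DHData` prime by prime -/

namespace Summit.ABC.IUTFork

open Literature.IUT.LogVolume NumberField IsDedekindDomain
open scoped Pointwise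

variable {F : Type} [Field F] [NumberField F]

namespace DHData

/-- **`DHData` from data at every index**: over the model `IndPacketModel.ofPrimewise Pall`, a family
`d p : (Pall p).DHDatum X` IS a Dupuy–Hilado datum — every field of `DHData` holds componentwise, `hull_adm`
through `UThetaUnion_eq_localUTheta`. [cite: DupuyHilado2025, §3.9, §4.10–4.12] -/
def ofPrimewise (X : PilotData F) (Pall : ∀ p : ℕ, PrimePacket F p) (d : ∀ p, (Pall p).DHDatum X)
    (T : Finset ℕ) (T_prime : ∀ p ∈ T, p.Prime) (S_sub : ∀ v ∈ X.S, residueChar F v ∈ T) : DHData F where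
  X := X
  M := IndPacketModel.ofPrimewise Pall
  T := T
  T_prime := T_prime
  S_sub := S_sub
  tΘ i p v := (d p).tΘ i v
  tΘ_ord i p v := (d p).tΘ_ord i v
  tq i p v := (d p).tq i v
  tq_ord i p v := (d p).tq_ord i v
  ind3 :=
    { bare3 := fun p => (d p).bare3
      bare3_adm := fun p j e => (d p).bare3_adm j e
      region_subset := fun p j e => (d p).region_subset j e
      subset_bound := fun p i e => (d p).subset_bound i e }
  hull_adm p j e := by
    rw [IndPacketModel.hullUTheta_eq_localHull]
    exact (d p).hull_adm j e

open Classical in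
/-- **`DHData` from REAL data at primes**: packets `P p hp` and data `d p hp` over them at every prime, completed
at the composite junk indices by the valuation line and its canonical datum. The model is
`IndPacketModel.ofPrimesLine P`. [cite: DupuyHilado2025, §3.9, §4.10–4.12] -/
def ofPrimesLine (X : PilotData F) (P : ∀ p : ℕ, p.Prime → PrimePacket F p)
    (d : ∀ (p : ℕ) (hp : p.Prime), (P p hp).DHDatum X)
    (T : Finset ℕ) (T_prime : ∀ p ∈ T, p.Prime) (S_sub : ∀ v ∈ X.S, residueChar F v ∈ T) : DHData F :=
  ofPrimewise X (fun p => if hp : p.Prime then P p hp else PrimePacket.line F p)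
    (fun p => if hp : p.Prime then
        PrimePacket.DHDatum.transport (dif_pos hp) (d p hp)
      else PrimePacket.DHDatum.transport (dif_neg hp) (PrimePacket.lineDatum p X))
    T T_prime S_sub

/-- The model of `ofPrimesLine` is `IndPacketModel.ofPrimesLine P`. [cite: DupuyHilado2025, Def. 3.6.3] -/
theorem ofPrimesLine_M (X : PilotData F) (P : ∀ p : ℕ, p.Prime → PrimePacket F p)
    (d : ∀ (p : ℕ) (hp : p.Prime), (P p hp).DHDatum X) (T : Finset ℕ) (T_prime : ∀ p ∈ T, p.Prime)
    (S_sub : ∀ v ∈ X.S, residueChar F v ∈ T) :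
    (ofPrimesLine X P d T T_prime S_sub).M = IndPacketModel.ofPrimesLine P := rfl

/-- The pilot data of `ofPrimesLine` is `X`. [cite: DupuyHilado2025, §3.3] -/
theorem ofPrimesLine_X (X : PilotData F) (P : ∀ p : ℕ, p.Prime → PrimePacket F p)
    (d : ∀ (p : ℕ) (hp : p.Prime), (P p hp).DHDatum X) (T : Finset ℕ) (T_prime : ∀ p ∈ T, p.Prime)
    (S_sub : ∀ v ∈ X.S, residueChar F v ∈ T) :
    (ofPrimesLine X P d T T_prime S_sub).X = X := rfl

end DHData

end Summit.ABC.IUTFork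

end
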